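import Summits.CriticalPhenomena.CardyFormulaZ2.Theorems.CardyIKTransportIKMixedBoxCrossingTransportMonoDefs
import Mathlib.LinearAlgebra.Matrix.Trace

/-!
# Line `defect-closure-exploration`, reshape v5 (lead c5) — VOCABULARY of the proof of `LastColLinkMono`
# (the one-dimensional link lemma) by GAP-CROSSING DOMINATION (crux `IKMixedBoxCrossing`, stmt-CriticalPhenomena-5911)

Definitions-only support file, companion of `…TransportMonoDefs.lean` (p134371).  Nothing is asserted: every `def … : Prop` is a
statement the LINE POSITS (a registered stub); the composition `lastColLinkMono_of` is sorry-free.  Paper proof: lead c5 memo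
`Cruxes/IKMixedBoxCrossing/Lines/defect-closure-exploration-c5.md` §9.

THE ARGUMENT.  Fix the interior `y` of the slab of `w` face columns; let `ξ` be its last cell column.  If `ξ` is constant the arcs
event does not depend on the new column (`LinkConst`).  Otherwise `ξ` is presented as a NECKLACE: `k ≥ 1` blocks, block `i` a black
run of `runLen i` cells followed (upwards) by a white gap of `gapLen i` cells, read from a base row (`Necklace`, `Necklace.col`;
existence: `NecklaceExists`).  For the new column `(c, f)` the gap `i` is CROSSED (`Necklace.cross`) when `c` is black on the gap,
black on the cell below it or carrying the main diagonal of the face below it, and black on the cell above it or carrying the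
anti-diagonal of its top face.  (H1, `LinkArcsIff`) the arcs event at `(y, c, f)` is the value at the crossing vector of the
INCREASING necklace function `Necklace.Phi` ("some interior cluster of the first arc is joined to one of the second arc along runs,
interior clusters and crossed gaps").  (H2, `LinkHonCount`) through a honeycomb face column the crossings are the events
"`c` black on `gapLen i + 1` disjoint cells", so their counts factor.  (H3, `LinkIsoTrace`) through an isotropic face column the
weight of a crossing pattern `x` is the trace of the cyclic product of `S^(runLen i - 1) · G (gapLen i) (x i)` with
`S = [[1,t],[t,1]]`, `t = √3/2`, `G g true = u uᵀ` (`u = (t, ½)`), `G g false = S^(g+1) − u uᵀ`.  (H4, `LinkTraceIneq`) THE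
ANALYTIC HEART: for every such cyclic product in which some gaps may already carry the free kernel `S^(g+1)`, switching one more
gap `i` satisfies `tr(… u uᵀ …) ≥ 2^{-(gapLen i + 1)} · tr(… S^(gapLen i + 1) …)` — the cone lemma of the memo (constant `432/427`).
(H5, `LinkTelescope`) telescoping over the gaps turns H4 into `Σ_x Φ(x) tr(prod x) ≥ tr(S^L) · Σ_x Φ(x) ∏_i π_i^{x_i}(1-π_i)^{1-x_i}`
for every increasing `Φ`.  `lastColLinkMono_of` assembles H1–H5 (+ `LinkConst`, `NecklaceExists`) into `LastColLinkMono`.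
-/

noncomputable section

namespace Summit.CriticalPhenomena.CardyFormulaZ2.Cruxes.IKMixedBoxCrossing.DefectClosureExploration

open scoped BigOperators Classical
open Finset Matrix
open Summit.CriticalPhenomena.CardyFormulaZ2.Theorems.IKLinearTransport.PinnedDiagramExchange (faceWeight)
open CylBunchStub (colConst splitEquiv)

/-! ## §1 Necklaces (cyclic run/gap presentations of a non-constant Boolean column) -/

/-- A necklace presentation of a cyclic Boolean column of length `L`: `k` blocks, block `i` consisting of a BLACK run of
`runLen i ≥ 1` cells followed (in the direction `r ↦ r + 1`) by a WHITE gap of `gapLen i ≥ 1` cells; the first cell of run `0`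
sits at row `base`; the block lengths add up to `L`. -/
structure Necklace (L : ℕ) where
  /-- number of blocks (= number of black runs = number of white gaps) -/
  k : ℕ
  /-- at least one block -/
  hk : 0 < k
  /-- length of the black run of block `i` -/
  runLen : Fin k → ℕ
  /-- length of the white gap of block `i` -/
  gapLen : Fin k → ℕ
  /-- runs are non-empty -/
  run_pos : ∀ i, 1 ≤ runLen i
  /-- gaps are non-empty -/
  gap_pos : ∀ i, 1 ≤ gapLen i
  /-- row of the first cell of run `0` -/
  base : ZMod L
  /-- the blocks tile the cycle -/
  total : ∑ i, (runLen i + gapLen i) = L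

namespace Necklace

variable {L : ℕ} (N : Necklace L)

/-- Offset (from `base`) of the first cell of the run of block `i`: the total length of the earlier blocks. -/
def runStart (i : Fin N.k) : ℕ := ∑ j ∈ Finset.univ.filter (fun j : Fin N.k => j < i), (N.runLen j + N.gapLen j)

/-- Offset of the first cell of the gap of block `i`. -/
def gapStart (i : Fin N.k) : ℕ := N.runStart i + N.runLen i

/-- The row at offset `o` from the base. -/
def row (o : ℕ) : ZMod L := N.base + (o : ZMod L)

/-- Offset `o` lies in the run of block `i`. -/
def InRun (i : Fin N.k) (o : ℕ) : Prop := N.runStart i ≤ o ∧ o < N.gapStart i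

/-- Offset `o` lies in the gap of block `i`. -/
def InGap (i : Fin N.k) (o : ℕ) : Prop := N.gapStart i ≤ o ∧ o < N.gapStart i + N.gapLen i

/-- The Boolean column presented by the necklace: black exactly on the runs (offsets taken modulo `L` through `row`;
a row is black iff it is `row o` for some offset `o < L` inside a run). -/
def col : ZMod L → Bool := fun r => decide (∃ i : Fin N.k, ∃ o : ℕ, o < L ∧ N.InRun i o ∧ N.row o = r)

/-- GAP CROSSING.  The new column (`c` colours, `f` flags of the face column between the presented column and the new one;
flag `true` = anti-diagonal `(previous, r+1) — (new, r)`, flag `false` = main diagonal `(previous, r) — (new, r+1)`) CROSSES the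
gap of block `i`: `c` is black on the whole gap, black on the cell below the gap or linked to it by the main diagonal of the face
below the gap, and black on the cell above the gap or linked to it by the anti-diagonal of the top face of the gap. -/
def cross (c f : ZMod L → Bool) (i : Fin N.k) : Bool :=
  decide ((∀ o, N.InGap i o → c (N.row o) = true) ∧
    (c (N.row (N.gapStart i - 1)) = true ∨ f (N.row (N.gapStart i - 1)) = false) ∧
    (c (N.row (N.gapStart i + N.gapLen i)) = true ∨ f (N.row (N.gapStart i + N.gapLen i - 1)) = true))

/-- The crossing vector of the new column. -/
def crossVec (c f : ZMod L → Bool) : Fin N.k → Bool := fun i => N.cross c f i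

/-! ## §2 The necklace link function of an interior configuration -/

variable {w : ℕ}

/-- The cells of the LAST interior cell column lying in the run of block `i`. -/
def runCells (i : Fin N.k) : Set (Fin (w + 1) × ZMod L) :=
  {u | u.1 = Fin.last w ∧ ∃ o, o < L ∧ N.InRun i o ∧ N.row o = u.2}

/-- Run `i` MEETS the arc of rows with `lo ≤ r.val < hi`: some cell of column `0` in that arc is black-connected, inside the
interior slab `y`, to some cell of run `i`. -/
def RunMeets (y : CylCfg w L) (lo hi : ℕ) (i : Fin N.k) : Prop :=
  ∃ r : ZMod L, lo ≤ r.val ∧ r.val < hi ∧ ∃ u ∈ N.runCells i, BlackConn y ((0 : Fin (w + 1)), r) u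

/-- Two runs are LINKED at the crossing vector `x`: consecutive blocks with the gap between them crossed, or runs of the
same interior cluster. -/
def Linked (y : CylCfg w L) (x : Fin N.k → Bool) (i j : Fin N.k) : Prop :=
  (x i = true ∧ j.val = (i.val + 1) % N.k) ∨ (x j = true ∧ i.val = (j.val + 1) % N.k) ∨
    ∃ u ∈ N.runCells i, ∃ v ∈ N.runCells j, BlackConn y u v

/-- THE NECKLACE LINK FUNCTION `Φ_y(x)` of the arcs event with parameter `n`: either the two arcs are already joined inside
the interior slab, or some run meeting the first arc is joined to some run meeting the second arc by a chain of links. -/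
def Phi (y : CylCfg w L) (n : ℕ) (x : Fin N.k → Bool) : Prop :=
  (∃ r₁ r₂ : ZMod L, n ≤ r₁.val ∧ r₁.val < 3 * n ∧ 5 * n ≤ r₂.val ∧ r₂.val < 7 * n ∧
      BlackConn y ((0 : Fin (w + 1)), r₁) ((0 : Fin (w + 1)), r₂)) ∨
    ∃ i j : Fin N.k, N.RunMeets y n (3 * n) i ∧ N.RunMeets y (5 * n) (7 * n) j ∧
      Relation.ReflTransGen (N.Linked y x) i j

/-- `Φ_y` is increasing in the crossing vector. -/
theorem Phi_mono (y : CylCfg w L) (n : ℕ) {x x' : Fin N.k → Bool} (hle : x ≤ x') (h : N.Phi y n x) : N.Phi y n x' := by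
  rcases h with h | ⟨i, j, hi, hj, hij⟩
  · exact Or.inl h
  · refine Or.inr ⟨i, j, hi, hj, Relation.ReflTransGen.mono (fun a b hab => ?_) _ _ hij⟩
    rcases hab with ⟨ha, hb⟩ | ⟨ha, hb⟩ | hc
    · exact Or.inl ⟨Bool.eq_true_of_true_le (ha ▸ hle a), hb⟩
    · exact Or.inr (Or.inl ⟨Bool.eq_true_of_true_le (ha ▸ hle b), hb⟩)
    · exact Or.inr (Or.inr hc)

end Necklace

/-! ## §3 The matrices of the isotropic kernel and the cyclic block products -/

/-- `t = √3/2`, the flip weight of the two-state chain of the isotropic column kernel. -/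
def tI : ℝ := Real.sqrt 3 / 2

/-- One step of the chain: `S = [[1, t], [t, 1]]` (stay `1`, flip `t`). -/
def Smat : Matrix (Fin 2) (Fin 2) ℝ := !![1, tI; tI, 1]

/-- `u = (t, ½)`: the crossed-gap kernel is `u uᵀ` (enter the gap by a flip or pay the bottom coin; leave likewise). -/
def uvec : Fin 2 → ℝ := ![tI, 1 / 2]

/-- The crossed-gap kernel `M¹ = u uᵀ` (independent of the gap length, `S[1][1] = 1`). -/
def M1 : Matrix (Fin 2) (Fin 2) ℝ := vecMulVec uvec uvec

/-- The free kernel across a gap of length `g`: `g + 1` chain steps. -/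
def Fmat (g : ℕ) : Matrix (Fin 2) (Fin 2) ℝ := Smat ^ (g + 1)

/-- The gap kernel with crossing value `b`: `M¹` if crossed, `S^(g+1) − M¹` if not. -/
def Gmat (g : ℕ) (b : Bool) : Matrix (Fin 2) (Fin 2) ℝ := if b then M1 else Fmat g - M1

/-- Probability that a honeycomb column crosses a gap of length `g`: black on `g + 1` prescribed cells. -/
def piG (g : ℕ) : ℝ := (1 / 2) ^ (g + 1)

/-- The honeycomb weight of the crossing value `b` of a gap of length `g`. -/
def pG (g : ℕ) (b : Bool) : ℝ := if b then piG g else 1 - piG g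

namespace Necklace

variable {L : ℕ} (N : Necklace L)

/-- HYBRID block of block `i`: the run steps `S^(runLen i - 1)` followed by the gap kernel — the free kernel if the gap is in
the converted set `T`, else the constrained kernel of the crossing value `x i`. -/
def block (T : Finset (Fin N.k)) (x : Fin N.k → Bool) (i : Fin N.k) : Matrix (Fin 2) (Fin 2) ℝ :=
  Smat ^ (N.runLen i - 1) * (if i ∈ T then Fmat (N.gapLen i) else Gmat (N.gapLen i) (x i))

/-- The cyclic (ordered) product of the hybrid blocks and its trace. -/
def prodMat (T : Finset (Fin N.k)) (x : Fin N.k → Bool) : Matrix (Fin 2) (Fin 2) ℝ :=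
  (List.ofFn fun i : Fin N.k => N.block T x i).prod

/-- Trace of the cyclic product: the (unnormalised) weight of the crossing pattern `x` with converted gaps `T`. -/
def W (T : Finset (Fin N.k)) (x : Fin N.k → Bool) : ℝ := (N.prodMat T x).trace

/-- The honeycomb (product) weight of the crossing pattern `x`. -/
def honW (x : Fin N.k → Bool) : ℝ := ∏ i, pG (N.gapLen i) (x i)

end Necklace

/-! ## §4 The statements (registered stubs) -/

/-- EXISTENCE OF NECKLACES: every cyclic Boolean column taking both values is presented by a necklace.
  A statement to be proved (registered stub), not asserted here. -/
def NecklaceExists : Prop :=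
  ∀ (L : ℕ) [NeZero L] (ξ : ZMod L → Bool), (∃ r, ξ r = true) → (∃ r, ξ r = false) → ∃ N : Necklace L, N.col = ξ

/-- CONSTANT LAST INTERIOR COLUMN: then the arcs event does not depend on the new column.
  A statement to be proved (registered stub), not asserted here. -/
def LinkConst : Prop :=
  ∀ (w L n : ℕ) [NeZero L] (y : CylCfg w L) (b : Bool), (∀ r, y.1 (Fin.last w, r) = b) →
    ∀ p q : (ZMod L → Bool) × (ZMod L → Bool),
      ((splitEquiv w L).symm (y, p) ∈ arcsEvent (w + 1) L n ↔ (splitEquiv w L).symm (y, q) ∈ arcsEvent (w + 1) L n)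

/-- H1 · ARCS EVENT = NECKLACE LINK FUNCTION AT THE CROSSING VECTOR (path surgery at the visits to the new column).
  A statement to be proved (registered stub), not asserted here. -/
def LinkArcsIff : Prop :=
  ∀ (w L n : ℕ) [NeZero L] (y : CylCfg w L) (N : Necklace L), N.col = (fun r => y.1 (Fin.last w, r)) →
    ∀ c f : ZMod L → Bool,
      ((splitEquiv w L).symm (y, (c, f)) ∈ arcsEvent (w + 1) L n ↔ N.Phi y n (N.crossVec c f))

/-- H2 · HONEYCOMB COUNT: through a honeycomb face column only `f ≡ true` carries weight, the crossings are "black on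
`gapLen i + 1` disjoint prescribed cells", and the number of columns `c` with a prescribed crossing pattern `x` is
`2^L · ∏_i pG (gapLen i) (x i)`.
  A statement to be proved (registered stub), not asserted here. -/
def LinkHonCount : Prop :=
  ∀ (L : ℕ) [NeZero L] (N : Necklace L) (x : Fin N.k → Bool),
    (∑ p : (ZMod L → Bool) × (ZMod L → Bool),
        if N.crossVec p.1 p.2 = x then lastColWeight false L N.col p.1 p.2 else 0) = (2 : ℝ) ^ L * N.honW x

/-- H3 · ISOTROPIC TRACE FORMULA: through an isotropic face column the total weight of the new columns with crossing
pattern `x` is the trace of the cyclic block product with no converted gap.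
  A statement to be proved (registered stub), not asserted here. -/
def LinkIsoTrace : Prop :=
  ∀ (L : ℕ) [NeZero L] (N : Necklace L) (x : Fin N.k → Bool),
    (∑ p : (ZMod L → Bool) × (ZMod L → Bool),
        if N.crossVec p.1 p.2 = x then lastColWeight true L N.col p.1 p.2 else 0) = N.W ∅ x

/-- H4 · THE TRACE INEQUALITY (cone lemma, memo §9; sharp constant `432/427`): converting one more gap `i ∉ T` to its
honeycomb weights does not increase the crossed weight relative to the total.
  A statement to be proved (registered stub), not asserted here. -/
def LinkTraceIneq : Prop :=
  ∀ (L : ℕ) (N : Necklace L) (T : Finset (Fin N.k)) (x : Fin N.k → Bool) (i : Fin N.k), i ∉ T → 3 ≤ L →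
    piG (N.gapLen i) * (N.W T (Function.update x i true) + N.W T (Function.update x i false)) ≤
      N.W T (Function.update x i true)

/-- H5 · TELESCOPING: for every increasing `Φ`, `Σ_x Φ(x) W ∅ x ≥ W univ · Σ_x Φ(x) honW x` (the fully converted trace
`W univ x = tr(S^L)` does not depend on `x`).  Follows from H4 by converting the gaps one at a time; stated separately to keep
the composition short.
  A statement to be proved (registered stub), not asserted here. -/
def LinkTelescope : Prop :=
  LinkTraceIneq → ∀ (L : ℕ) (N : Necklace L), 3 ≤ L → ∀ Φ : (Fin N.k → Bool) → Prop, (∀ x x', x ≤ x' → Φ x → Φ x') →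
    N.W Finset.univ (fun _ => true) * (∑ x : Fin N.k → Bool, if Φ x then N.honW x else 0) ≤
      ∑ x : Fin N.k → Bool, if Φ x then N.W ∅ x else 0

/-- NORMALISATIONS: `colConst false L = 2^L` and `colConst true L = W univ` (the trace of `S^L`) for every necklace.
  A statement to be proved (registered stub), not asserted here. -/
def LinkNorm : Prop :=
  ∀ (L : ℕ) [NeZero L] (N : Necklace L),
    colConst false L = (2 : ℝ) ^ L ∧ colConst true L = N.W Finset.univ (fun _ => true) ∧
      0 < N.W Finset.univ (fun _ => true)

/-! ## §5 Registered stub names and the composition -/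

namespace Registered

/-- Alias keyed by the registered stub name. -/
abbrev stub_necklaceExists : Prop := NecklaceExists
/-- Alias keyed by the registered stub name. -/
abbrev stub_linkConst : Prop := LinkConst
/-- Alias keyed by the registered stub name (H1). -/
abbrev stub_linkArcsIff : Prop := LinkArcsIff
/-- Alias keyed by the registered stub name (H2). -/
abbrev stub_linkHonCount : Prop := LinkHonCount
/-- Alias keyed by the registered stub name (H3). -/
abbrev stub_linkIsoTrace : Prop := LinkIsoTrace
/-- Alias keyed by the registered stub name (H4, the analytic heart). -/
abbrev stub_linkTraceIneq : Prop := LinkTraceIneq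
/-- Alias keyed by the registered stub name (H5). -/
abbrev stub_linkTelescope : Prop := LinkTelescope
/-- Alias keyed by the registered stub name. -/
abbrev stub_linkNorm : Prop := LinkNorm

end Registered

/-- Regrouping a sum over the new columns by the value of the crossing vector. -/
theorem sum_fiber_crossVec {L : ℕ} [NeZero L] (N : Necklace L) (g : (ZMod L → Bool) × (ZMod L → Bool) → ℝ)
    (P : (Fin N.k → Bool) → Prop) :
    (∑ p : (ZMod L → Bool) × (ZMod L → Bool), if P (N.crossVec p.1 p.2) then g p else 0) =
      ∑ x : Fin N.k → Bool, if P x then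
        (∑ p : (ZMod L → Bool) × (ZMod L → Bool), if N.crossVec p.1 p.2 = x then g p else 0) else 0 := by
  have hx : ∀ x : Fin N.k → Bool, (if P x then
      (∑ p : (ZMod L → Bool) × (ZMod L → Bool), if N.crossVec p.1 p.2 = x then g p else 0) else 0) =
      ∑ p : (ZMod L → Bool) × (ZMod L → Bool), if N.crossVec p.1 p.2 = x then (if P x then g p else 0) else 0 := by
    intro x
    by_cases hP : P x
    · simp only [if_pos hP]
    · simp only [if_neg hP]
      rw [Finset.sum_eq_zero fun p _ => by split_ifs <;> rfl]
  simp_rw [hx]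
  rw [Finset.sum_comm]
  refine Finset.sum_congr rfl fun p _ => ?_
  rw [Finset.sum_ite_eq]
  simp only [Finset.mem_univ, if_true]

/-- **`LastColLinkMono` from the registered stubs of the link decomposition** (no `sorry`). -/
theorem lastColLinkMono_of : NecklaceExists → LinkConst → LinkArcsIff → LinkHonCount → LinkIsoTrace →
    LinkTelescope → LinkTraceIneq → LinkNorm → LastColLinkMono := by
  intro hN hC h1 h2 h3 h5 h4 hn w L n _ hL y
  set ξ : ZMod L → Bool := fun r => y.1 (Fin.last w, r) with hξ
  set E := arcsEvent (w + 1) L n with hE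
  have hcF : 0 < colConst false L := CylBunchStub.colConst_pos false L
  have hcT : 0 < colConst true L := CylBunchStub.colConst_pos true L
  by_cases hconst : ∃ b : Bool, ∀ r, ξ r = b
  · -- constant last interior column: the event does not depend on the new column
    obtain ⟨b, hb⟩ := hconst
    have key : ∀ b' : Bool, lastColSum b' L E y =
        (if (splitEquiv w L).symm (y, (fun _ => false, fun _ => true)) ∈ E then 1 else 0) * colConst b' L := by
      intro b'
      unfold lastColSum
      have hiff := fun p : (ZMod L → Bool) × (ZMod L → Bool) =>
        hC w L n y b hb p (fun _ => false, fun _ => true)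
      by_cases hmem : (splitEquiv w L).symm (y, (fun _ => false, fun _ => true)) ∈ E
      · rw [if_pos hmem, one_mul]
        rw [show colConst b' L = ∑ p : (ZMod L → Bool) × (ZMod L → Bool),
            lastColWeight b' L (fun r => y.1 (Fin.last w, r)) p.1 p.2 from ?_]
        · exact Finset.sum_congr rfl fun p _ => by rw [if_pos ((hiff p).2 hmem)]
        · rw [← CylBunchStub.colSum_eq_colConst b' L (fun r => y.1 (Fin.last w, r)), Fintype.sum_prod_type]
          rfl
      · rw [if_neg hmem, zero_mul]
        exact Finset.sum_eq_zero fun p _ => by rw [if_neg (fun h => hmem ((hiff p).1 h))]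
    rw [key false, key true, mul_div_assoc, mul_div_assoc, div_self hcF.ne', div_self hcT.ne']
  · -- non-constant: necklace presentation
    push Not at hconst
    have htrue : ∃ r, ξ r = true := by
      by_contra h
      push Not at h
      obtain ⟨r, hr⟩ := hconst false
      exact hr (by simpa using h r)
    have hfalse : ∃ r, ξ r = false := by
      by_contra h
      push Not at h
      obtain ⟨r, hr⟩ := hconst true
      exact hr (by simpa using h r)
    obtain ⟨N, hNcol⟩ := hN L ξ htrue hfalse
    obtain ⟨hnF, hnT, hWpos⟩ := hn L N
    have hsum : ∀ b' : Bool, lastColSum b' L E y = ∑ x : Fin N.k → Bool, if N.Phi y n x then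
        (∑ p : (ZMod L → Bool) × (ZMod L → Bool),
          if N.crossVec p.1 p.2 = x then lastColWeight b' L N.col p.1 p.2 else 0) else 0 := by
      intro b'
      unfold lastColSum
      rw [← sum_fiber_crossVec N (fun p => lastColWeight b' L N.col p.1 p.2) (N.Phi y n)]
      refine Finset.sum_congr rfl fun p _ => ?_
      rw [hNcol]
      obtain ⟨c, f⟩ := p
      by_cases hm : (splitEquiv w L).symm (y, (c, f)) ∈ E
      · rw [if_pos hm, if_pos ((h1 w L n y N hNcol c f).1 hm)]
      · rw [if_neg hm, if_neg (fun h => hm ((h1 w L n y N hNcol c f).2 h))]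
    have hF : lastColSum false L E y = (2 : ℝ) ^ L * ∑ x : Fin N.k → Bool, if N.Phi y n x then N.honW x else 0 := by
      rw [hsum false, Finset.mul_sum]
      refine Finset.sum_congr rfl fun x _ => ?_
      split_ifs
      · exact h2 L N x
      · rw [mul_zero]
    have hT : lastColSum true L E y = ∑ x : Fin N.k → Bool, if N.Phi y n x then N.W ∅ x else 0 := by
      rw [hsum true]
      refine Finset.sum_congr rfl fun x _ => ?_
      split_ifs
      · exact h3 L N x
      · rfl
    have htel := h5 h4 L N hL (N.Phi y n) (fun x x' hle hx => N.Phi_mono y n hle hx)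
    rw [hF, hT, hnF, hnT, mul_div_cancel_left₀ _ (by positivity), le_div_iff₀ hWpos]
    linarith [mul_comm (N.W Finset.univ (fun _ => true)) (∑ x : Fin N.k → Bool, if N.Phi y n x then N.honW x else 0)]
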